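import Summits.Parity.GeneralizedHardyLittlewood.Theorems.LiouvilleShiftedTablesSieveToMAvgTelescope
import Literature.NumberTheory.Sieve.DivisorPowerSums

/-!
# Sieve glue for `SieveToMAvg`, part 3: dyadic boxes for the log-free Heath-Brown pieces

Support file for item stmt-Parity-14274 (route `LiouvilleShiftedTables`).  The log-free piece
`hbPieceT U j t = μ_{≤U}^{⋆j} ⋆ ζ^{⋆(j−1)} ⋆ ζ_{>t}` (part 2) is the Dirichlet product of the `2j`
factors `gFactor U j t i` (`i < 2j`).  Each factor is cut into the DYADIC boxes
`(2x/2^{k+1}, 2x/2^k]`, `k < K` (`2x < 2^K`), i.e. the boxes of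
`Literature.NumberTheory.Sieve.BFI.boxRestrict` with `T = 2x`, `Δ = 1`; the multilinear expansion
`hbPieceT U j t (n) = ∑_κ prodB κ (n)` (`n ≤ 2x`, `κ : Fin (2j) → {0,…,K−1}`) then gives
`TT(hbPieceT) ≤ ∑_κ TT(prodB κ)` for the correlation functional of part 1, with
`∑_κ |prodB κ (n)| ≤ τ(n)^{2j}` pointwise and the support of every sub-product of boxed factors inside
`(∏ P_i, 2^{#S} ∏ P_i]`, `P_i = 2x/2^{κ_i + 1}`.
-/

namespace Summit.Parity.GeneralizedHardyLittlewood.Theorems.SieveToMAvg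

open Finset Real
open scoped ArithmeticFunction.zeta ArithmeticFunction.sigma
open Literature.NumberTheory.Sieve (moebiusTrunc moebiusTrunc_apply abs_prod_apply_le_sigma_zero_pow)
open Literature.NumberTheory.Sieve.BFI

section Factors

variable (U j t : ℕ)

/-- The `i`-th factor of the log-free piece: `μ_{≤U}` for `i < j`, `ζ` for `j ≤ i < 2j − 1`,
`ζ_{>t}` for `i = 2j − 1` (and beyond). [folklore] -/
noncomputable def gFactor (i : ℕ) : ArithmeticFunction ℝ :=
  if i < j then (moebiusTrunc U : ArithmeticFunction ℝ)
  else if i < 2 * j - 1 then (ζ : ArithmeticFunction ℝ) else zetaGt t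

/-- `hbPieceT U j t = ∏_{i<2j} gFactor U j t i` (`j ≥ 1`). [folklore] -/
theorem hbPieceT_eq_prod (hj : 1 ≤ j) : hbPieceT U j t = ∏ i ∈ Finset.range (2 * j), gFactor U j t i := by
  have h2j : 2 * j = (2 * j - 1) + 1 := by omega
  rw [h2j, Finset.prod_range_succ, ← Finset.prod_range_mul_prod_Ico _ (show j ≤ 2 * j - 1 by omega)]
  have h1 : ∏ i ∈ Finset.range j, gFactor U j t i = (moebiusTrunc U : ArithmeticFunction ℝ) ^ j := by
    rw [Finset.prod_congr rfl (fun i hi => by rw [gFactor, if_pos (Finset.mem_range.1 hi)]),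
      Finset.prod_const, Finset.card_range]
  have h2 : ∏ i ∈ Finset.Ico j (2 * j - 1), gFactor U j t i = (ζ : ArithmeticFunction ℝ) ^ (j - 1) := by
    rw [Finset.prod_congr rfl (fun i hi => by
      obtain ⟨hi1, hi2⟩ := Finset.mem_Ico.1 hi
      rw [gFactor, if_neg (not_lt.2 hi1), if_pos hi2]), Finset.prod_const, Nat.card_Ico]
    congr 1; omega
  have h3 : gFactor U j t (2 * j - 1) = zetaGt t := by
    rw [gFactor, if_neg (by omega), if_neg (lt_irrefl _)]
  rw [h1, h2, h3]
  rfl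

/-- `|gFactor i (n)| ≤ 1`. [folklore] -/
theorem abs_gFactor_le_one (i n : ℕ) : |gFactor U j t i n| ≤ 1 := by
  unfold gFactor
  split_ifs
  · rw [ArithmeticFunction.intCoe_apply, moebiusTrunc_apply]
    split_ifs
    · exact_mod_cast ArithmeticFunction.abs_moebius_le_one
    · simp
  · rw [ArithmeticFunction.natCoe_apply, ArithmeticFunction.zeta_apply]
    split_ifs <;> simp
  · exact abs_zetaGt_le_one t n

/-- A Möbius factor is supported on `[1, U]`. [folklore] -/
theorem le_of_gFactor_ne_zero {i n : ℕ} (hi : i < j) (h : gFactor U j t i n ≠ 0) : n ≤ U := by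
  rw [gFactor, if_pos hi, ArithmeticFunction.intCoe_apply, moebiusTrunc_apply] at h
  by_contra hn
  rw [if_neg hn] at h
  exact h (by simp)

/-- A smooth factor (`j ≤ i`) is an indicator: its value at `n ≥ 1` is `1` unless `i ≥ 2j−1` and `n ≤ t`,
when it is `0`. [folklore] -/
theorem gFactor_apply_of_le {i n : ℕ} (hi : j ≤ i) (hn : n ≠ 0) :
    gFactor U j t i n = if i < 2 * j - 1 ∨ t < n then 1 else 0 := by
  rw [gFactor, if_neg (not_lt.2 hi)]
  split_ifs with h1 h2 h2
  · rw [ArithmeticFunction.natCoe_apply, ArithmeticFunction.zeta_apply_ne hn, Nat.cast_one]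
  · exact absurd (Or.inl h1) h2
  · rw [zetaGt_apply, if_pos (h2.resolve_left h1)]
  · rw [zetaGt_apply, if_neg (fun h => h2 (Or.inr h))]

end Factors

section Boxes

variable (x : ℝ) (U j t : ℕ)

/-- The boxed factor: `gFactor i` restricted to the dyadic box `(2x/2^{k+1}, 2x/2^k]`. [folklore] -/
noncomputable def bFactor (i k : ℕ) : ArithmeticFunction ℝ := boxRestrict (2 * x) 1 k (gFactor U j t i)

/-- The boxed product of a tuple `κ`: `prodB κ = ∏_{i<2j} bFactor i (κ i)`. [folklore] -/
noncomputable def prodB (κ : Fin (2 * j) → ℕ) : ArithmeticFunction ℝ :=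
  ∏ i : Fin (2 * j), bFactor x U j t i (κ i)

/-- The lower end `P_k = 2x/2^{k+1}` of the `k`-th dyadic box. [folklore] -/
noncomputable def P (k : ℕ) : ℝ := boxLow (2 * x) 1 k

variable {x U j t}

/-- `P_k = 2x / 2^{k+1}`. [folklore] -/
theorem P_eq (k : ℕ) : P x k = 2 * x / 2 ^ (k + 1) := by
  unfold P boxLow; norm_num

/-- `0 < P_k` for `x > 0`. [folklore] -/
theorem P_pos (hx : 0 < x) (k : ℕ) : 0 < P x k := boxLow_pos (by linarith) (by norm_num) k

/-- `P_k ≤ x` for `x ≥ 0`. [folklore] -/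
theorem P_le (hx : 0 ≤ x) (k : ℕ) : P x k ≤ x := by
  rw [P_eq, div_le_iff₀ (by positivity), pow_succ]
  have : (1 : ℝ) ≤ 2 ^ k := one_le_pow₀ (by norm_num)
  nlinarith

/-- The `k`-th dyadic box is `(P_k, 2 P_k]`. [folklore] -/
theorem inBox_iff {k n : ℕ} : InBox (2 * x) 1 k n ↔ 0 < n ∧ P x k < n ∧ (n : ℝ) ≤ 2 * P x k := by
  unfold InBox P
  rw [boxHigh_eq_mul_boxLow (by norm_num : (-1 : ℝ) < 1)]
  norm_num

/-- `|bFactor i k (n)| ≤ 1`. [folklore] -/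
theorem abs_bFactor_le_one (i k n : ℕ) : |bFactor x U j t i k n| ≤ 1 :=
  (abs_boxRestrict_le _ _ _).trans (abs_gFactor_le_one U j t i n)

/-- The support of a boxed factor: the box, and the support of the factor. [folklore] -/
theorem bFactor_ne_zero {i k n : ℕ} (h : bFactor x U j t i k n ≠ 0) :
    (0 < n ∧ P x k < n ∧ (n : ℝ) ≤ 2 * P x k) ∧ gFactor U j t i n ≠ 0 := by
  obtain ⟨h1, h2⟩ := boxRestrict_ne_zero h
  exact ⟨inBox_iff.1 h1, h2⟩

/-- A boxed SMOOTH factor (`j ≤ i`) is the indicator of `(P_k, 2P_k] ∩ (t', ∞)` with `t' = t` in the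
last slot and `t' = 0` otherwise. [folklore] -/
theorem bFactor_apply_of_le {i : ℕ} (hi : j ≤ i) (k n : ℕ) :
    bFactor x U j t i k n =
      if (P x k < n ∧ (n : ℝ) ≤ 2 * P x k) ∧ (if i < 2 * j - 1 then 0 else t) < n then 1 else 0 := by
  unfold bFactor
  rw [boxRestrict_apply]
  by_cases hin : InBox (2 * x) 1 k n
  · have hn0 : n ≠ 0 := hin.1.ne'
    obtain ⟨hn1, hPn, hn2⟩ := inBox_iff.1 hin
    rw [if_pos hin, gFactor_apply_of_le U j t hi hn0]
    by_cases hi2 : i < 2 * j - 1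
    · simp [hi2, hPn, hn2, hn1]
    · simp [hi2, hPn, hn2]
  · rw [if_neg hin, if_neg]
    rintro ⟨⟨h1, h2⟩, h3⟩
    exact hin (inBox_iff.2 ⟨by omega, h1, h2⟩)

/-! ### The multilinear expansion and `TT` -/

/-- **Expansion into box-tuples**: for `j ≥ 1`, `x > 0`, `2x < 2^K` and `n ≤ 2x`,
`hbPieceT U j t (n) = ∑_{κ ∈ tuples j K} prodB κ (n)`. [folklore] -/
theorem hbPieceT_apply_eq_sum (hj : 1 ≤ j) (hx : 0 < x) {K : ℕ} (hK : 2 * x < 2 ^ K) {n : ℕ}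
    (hn : (n : ℝ) ≤ 2 * x) :
    hbPieceT U j t n = ∑ κ ∈ tuples j K, prodB x U j t κ n := by
  rw [hbPieceT_eq_prod U j t hj, Finset.prod_range]
  have hK' : 2 * x < (1 + 1) ^ K := by norm_num; exact hK
  have h := prod_apply_eq_sum_prod_boxRestrict_apply (T := 2 * x) (Δ := 1) (by linarith) one_pos hK'
    (fun i : Fin (2 * j) => gFactor U j t i) hn
  rw [h]
  rfl

/-- **`TT` of a log-free piece through its box-tuples**: `TT(hbPieceT U j t) ≤ ∑_κ TT(prodB κ)`. [folklore] -/
theorem TT_hbPieceT_le_sum (w : ℕ → ℝ) (h Q : ℕ) (hj : 1 ≤ j) (hx : 0 < x) {K : ℕ} (hK : 2 * x < 2 ^ K) :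
    TT w h Q x (fun n => hbPieceT U j t n) ≤ ∑ κ ∈ tuples j K, TT w h Q x (fun n => prodB x U j t κ n) := by
  have hcongr : ∀ n ∈ Ioc ⌊x⌋₊ ⌊2 * x⌋₊, hbPieceT U j t n = ∑ κ ∈ tuples j K, prodB x U j t κ n := by
    intro n hn
    refine hbPieceT_apply_eq_sum hj hx hK ?_
    exact le_trans (by exact_mod_cast (Finset.mem_Ioc.1 hn).2) (Nat.floor_le (by linarith))
  rw [TT_congr w h Q x hcongr]
  exact TT_sum_le' w h Q x _ _

/-! ### Pointwise bounds -/

/-- `∑_{k<K} |bFactor i k (d)| ≤ ζ(d)` (at most one box contains `d`, and `|gFactor| ≤ 1`). [folklore] -/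
theorem sum_abs_bFactor_le (hx : 0 < x) (i K d : ℕ) :
    ∑ k ∈ Finset.range K, |bFactor x U j t i k d| ≤ ((ζ : ArithmeticFunction ℝ)) d := by
  rcases Nat.eq_zero_or_pos d with rfl | hd
  · simp
  rw [ArithmeticFunction.natCoe_apply, ArithmeticFunction.zeta_apply_ne hd.ne', Nat.cast_one]
  unfold bFactor
  exact (sum_abs_boxRestrict_le (T := 2 * x) (Δ := 1) (by linarith) zero_le_one K _ d).trans
    (abs_gFactor_le_one U j t i d)

/-- **Pointwise bound summed over all tuples**: `∑_κ |prodB κ (n)| ≤ τ(n)^{2j}`. [folklore] -/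
theorem sum_abs_prodB_le (hx : 0 < x) (K n : ℕ) :
    ∑ κ ∈ tuples j K, |prodB x U j t κ n| ≤ (σ 0 n : ℝ) ^ (2 * j) := by
  unfold tuples prodB
  refine (sum_abs_prod_apply_le (Finset.range K)
    (fun (i : Fin (2 * j)) (k : ℕ) => bFactor x U j t i.val k) n).trans ?_
  have hle : (∏ i : Fin (2 * j), ∑ k ∈ Finset.range K, absAF (bFactor x U j t i.val k)) n ≤
      (∏ _i : Fin (2 * j), (ζ : ArithmeticFunction ℝ)) n := by
    refine prod_apply_le_prod_apply (Finset.univ : Finset (Fin (2 * j))) (fun i _ d => ?_) (fun i _ d => ?_) n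
    · rw [Literature.NumberTheory.Sieve.HeathBrown.finset_sum_apply]
      exact Finset.sum_nonneg fun _ _ => abs_nonneg _
    · rw [Literature.NumberTheory.Sieve.HeathBrown.finset_sum_apply]
      simp only [absAF_apply]
      exact sum_abs_bFactor_le hx i K d
  exact hle.trans (prod_zeta_apply_le _ _)

/-- `|prodB κ (n)| ≤ τ(n)^{2j}` for a single tuple. [folklore] -/
theorem abs_prodB_le (κ : Fin (2 * j) → ℕ) (n : ℕ) : |prodB x U j t κ n| ≤ (σ 0 n : ℝ) ^ (2 * j) := by
  unfold prodB
  have h := abs_prod_apply_le_sigma_zero_pow (Finset.univ : Finset (Fin (2 * j)))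
    (fun i => bFactor x U j t i (κ i)) (fun i _ d => abs_bFactor_le_one i (κ i) d) n
  rwa [Finset.card_univ, Fintype.card_fin] at h

/-- A sub-product of boxed factors over a set `S` of slots is bounded by `τ^{#S}`. [folklore] -/
theorem abs_subprod_le (κ : Fin (2 * j) → ℕ) (S : Finset (Fin (2 * j))) (n : ℕ) :
    |(∏ i ∈ S, bFactor x U j t i (κ i)) n| ≤ (σ 0 n : ℝ) ^ S.card :=
  abs_prod_apply_le_sigma_zero_pow S (fun i => bFactor x U j t i (κ i)) (fun i _ d => abs_bFactor_le_one i (κ i) d) n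

/-! ### Supports -/

/-- The support of a sub-product over a nonempty set `S` of slots lies in
`(∏_{i∈S} P_{κ i}, 2^{#S} ∏_{i∈S} P_{κ i}]`. [folklore] -/
theorem subprod_ne_zero (hx : 0 < x) (κ : Fin (2 * j) → ℕ) {S : Finset (Fin (2 * j))} (hS : S.Nonempty)
    {n : ℕ} (hn : (∏ i ∈ S, bFactor x U j t i (κ i)) n ≠ 0) :
    (∏ i ∈ S, P x (κ i)) < n ∧ (n : ℝ) ≤ 2 ^ S.card * ∏ i ∈ S, P x (κ i) := by
  have hb := prod_apply_ne_zero_bounds hS (f := fun i => bFactor x U j t i (κ i))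
    (a := fun i => P x (κ i)) (b := fun i => 2 * P x (κ i))
    (fun i _ => (P_pos hx (κ i)).le)
    (fun i _ d hd => ⟨(bFactor_ne_zero hd).1.2.1, (bFactor_ne_zero hd).1.2.2⟩) hn
  refine ⟨hb.1, hb.2.trans_eq ?_⟩
  rw [Finset.prod_mul_distrib, Finset.prod_const]

/-- The support of `prodB κ`: `(∏_i P_{κ i}, 2^{2j} ∏_i P_{κ i}]` (`j ≥ 1`). [folklore] -/
theorem prodB_ne_zero (hj : 1 ≤ j) (hx : 0 < x) (κ : Fin (2 * j) → ℕ) {n : ℕ} (hn : prodB x U j t κ n ≠ 0) :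
    (∏ i, P x (κ i)) < n ∧ (n : ℝ) ≤ 2 ^ (2 * j) * ∏ i, P x (κ i) := by
  have huniv : (Finset.univ : Finset (Fin (2 * j))).Nonempty := ⟨⟨0, by omega⟩, Finset.mem_univ _⟩
  have h := subprod_ne_zero hx κ huniv (n := n) (by unfold prodB at hn; exact hn)
  rwa [Finset.card_univ, Fintype.card_fin] at h

/-- In a tuple with a nonzero value, every Möbius slot `i < j` has `P_{κ i} < U`. [folklore] -/
theorem P_lt_of_prodB_ne_zero (κ : Fin (2 * j) → ℕ) {n : ℕ} (hn : prodB x U j t κ n ≠ 0)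
    (i : Fin (2 * j)) (hi : (i : ℕ) < j) : P x (κ i) < U := by
  classical
  -- some divisor `d` of `n` lies in the box of slot `i` and has `gFactor i d ≠ 0`, so `d ≤ U`
  unfold prodB at hn
  rw [← Finset.mul_prod_erase _ _ (Finset.mem_univ i), ArithmeticFunction.mul_apply] at hn
  obtain ⟨p, hp, hp0⟩ := Finset.exists_ne_zero_of_sum_ne_zero hn
  have hd : bFactor x U j t i (κ i) p.1 ≠ 0 := left_ne_zero_of_mul hp0
  obtain ⟨⟨_, hPd, _⟩, hg⟩ := bFactor_ne_zero hd
  have hdU : p.1 ≤ U := le_of_gFactor_ne_zero U j t hi hg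
  exact hPd.trans_le (by exact_mod_cast hdU)

end Boxes

end Summit.Parity.GeneralizedHardyLittlewood.Theorems.SieveToMAvg
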